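import Mathlib
import Literature.NumberTheory.LFunctions.Zhang2022.TypedSection10B
import HarnessLib

/-!
# Zhang (2022) §10, Z22:§10.u039: `β_{j+1}β_{j+2}log P = −(11 − 6j + j²)πα + o(α)` — DISCHARGED

Topic `Literature/NumberTheory/LFunctions/Zhang2022` (Landau–Siegel audit tree; verdict-neutral).
Y. Zhang, *Discrete mean estimates and the Landau–Siegel zero*, arXiv:2211.02515v1 (2022)
[Zhang2022LandauSiegel], §10 p. 58 (tex L2951): "Noting that `β_{j+1}β_{j+2}log P = −(11 − 6j + j²)πα
+ o(α)`" — the node `Z22:§10.u039`, typed as `Typed.Sec10B.BetaProd1039 c'` in `TypedSection10B.lean`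
(L3-t2). **An unrefereed manuscript under adjudication; this file proves one elementary claim about
its PARAMETERS (2.13) and asserts nothing else.**

The claim is a statement about the shifts `β₁ = iα(1 − 5c′α𝓛)`, `β₂ = 2iα(1 + c′α𝓛)`,
`β₃ = 3iα(1 − c′α𝓛)` (2.13) (`β₄ = β₁`, `β₅ = β₂`, `Skeleton.betaJ`), `α = π/log P` (2.10) and
`log P = 𝓛⁹` (2.6) only: with `u = α𝓛 = π/𝓛⁸`,
`β₂β₃log P = −6πα(1 − c′²u²)`, `β₃β₁log P = −3πα(1 − 6c′u + 5c′²u²)`, `β₁β₂log P = −2πα(1 − 4c′u − 5c′²u²)`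
(`betaProd_cases`, exact), and `11 − 6j + j² = 6, 3, 2`; since `u → 0` the remainders are `o(α)`
(`betaProd1039_holds`: for `ε > 0` take `𝓛 ≥ π/δ + 1`, `δ = min(1, ε/(π(18|c′| + 21c′²) + 1))`).
Theorem-only; 0 new definitions, 0 facts.

## References

* Y. Zhang, arXiv:2211.02515v1 (2022), §10 p. 58; §2 (2.6), (2.10), (2.13).
  [cite: Zhang2022LandauSiegel, §10 p. 58]
-/

noncomputable section

open Complex Real
open Literature.NumberTheory.LFunctions.Zhang2022.Skeleton

namespace Literature.NumberTheory.LFunctions.Zhang2022.Typed.Sec10B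

/-- `Z22:§10.u039` (helper) `log D ≥ L` once `D ≥ ⌈e^L⌉`. [folklore] -/
private theorem le_ell_of_ceil_exp_le {L : ℝ} {D : ℕ} (hD : ⌈Real.exp L⌉₊ ≤ D) : L ≤ ell D := by
  rw [ell]
  have hD' : Real.exp L ≤ (D : ℝ) := (Nat.le_ceil _).trans (by exact_mod_cast hD)
  have hpos : (0 : ℝ) < D := (Real.exp_pos L).trans_le hD'
  exact (Real.le_log_iff_exp_le hpos).mpr hD'

/-- `Z22:§10.u039` (helper) `log P = 𝓛⁹`. [cite: Zhang2022LandauSiegel, §2 (2.6)] -/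
private theorem logP_eq_loc (D : ℕ) : logP D = ell D ^ 9 := by
  rw [logP, bigP, Real.log_exp]

/-- `Z22:§10.u039` (helper) `α = π/𝓛⁹`. [cite: Zhang2022LandauSiegel, §2 (2.10)] -/
private theorem alpha_eq (D : ℕ) : alpha D = π / ell D ^ 9 := by
  rw [alpha, bigP, Real.log_exp]

/-- `Z22:§10.u039` (helper) the three products at `j = 1, 2, 3`, exactly, in terms of `u = α𝓛`:
`β₂β₃log P + 6πα = 6πc′²α·u²`, `β₃β₁log P + 3πα = πα·u·(18c′ − 15c′²u)`,
`β₁β₂log P + 2πα = πα·u·(8c′ + 10c′²u)`. [cite: Zhang2022LandauSiegel, §10 p. 58] -/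
private theorem betaProd_cases (c' : ℝ) {D : ℕ} (hℓ : 0 < ell D) :
    (betaJ c' D 2 * betaJ c' D 3 * logP D + nQuad 1 * π * alpha D =
        ((6 * π * c' ^ 2 * alpha D * (alpha D * ell D) ^ 2 : ℝ) : ℂ)) ∧
    (betaJ c' D 3 * betaJ c' D 4 * logP D + nQuad 2 * π * alpha D =
        ((π * alpha D * (alpha D * ell D) * (18 * c' - 15 * c' ^ 2 * (alpha D * ell D)) : ℝ) : ℂ)) ∧
    (betaJ c' D 4 * betaJ c' D 5 * logP D + nQuad 3 * π * alpha D =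
        ((π * alpha D * (alpha D * ell D) * (8 * c' + 10 * c' ^ 2 * (alpha D * ell D)) : ℝ) : ℂ)) := by
  have h9 : ell D ^ 9 ≠ 0 := pow_ne_zero _ hℓ.ne'
  have hα : alpha D = π / ell D ^ 9 := alpha_eq D
  have hL : logP D = ell D ^ 9 := logP_eq_loc D
  refine ⟨?_, ?_, ?_⟩ <;>
  · simp only [betaJ, beta1, beta2, beta3, nQuad, hα, hL]
    norm_num
    field_simp
    ring_nf
    simp only [Complex.I_sq]
    ring

/-- `Z22:§10.u039` (helper) a normed bound `|πα·u·(A c′ + B c′² u)| ≤ πα·u·(|A||c′| + |B|c′²)` for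
`0 ≤ u ≤ 1`, `α ≥ 0`. [folklore] -/
private theorem abs_remainder_le {α u c A B : ℝ} (hα : 0 ≤ α) (hu0 : 0 ≤ u) (hu1 : u ≤ 1) :
    |π * α * u * (A * c + B * c ^ 2 * u)| ≤ π * α * u * (|A| * |c| + |B| * c ^ 2) := by
  rw [abs_mul, abs_of_nonneg (by positivity : 0 ≤ π * α * u)]
  gcongr
  calc |A * c + B * c ^ 2 * u| ≤ |A * c| + |B * c ^ 2 * u| := abs_add_le _ _
    _ = |A| * |c| + |B| * c ^ 2 * u := by
        rw [abs_mul, abs_mul, abs_mul, abs_of_nonneg (sq_nonneg c), abs_of_nonneg hu0]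
    _ ≤ |A| * |c| + |B| * c ^ 2 := by
        have : |B| * c ^ 2 * u ≤ |B| * c ^ 2 * 1 := by gcongr
        linarith

/-- `Z22:§10.u039` holds (DISCHARGED): "`β_{j+1}β_{j+2}log P = −(11 − 6j + j²)πα + o(α)`" for the
printed shifts (2.13) (`β₁ = iα(1−5c′α𝓛)`, `β₂ = 2iα(1+c′α𝓛)`, `β₃ = 3iα(1−c′α𝓛)`, `β₄ = β₁`,
`β₅ = β₂`) and `α = π/log P`, `log P = 𝓛⁹`: the products are `−6πα(1 − c′²u²)`, `−3πα(1 − 6c′u + 5c′²u²)`,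
`−2πα(1 − 4c′u − 5c′²u²)` with `u = α𝓛 = π/𝓛⁸ → 0`. [cite: Zhang2022LandauSiegel, §10 p. 58] -/
theorem betaProd1039_holds (c' : ℝ) : BetaProd1039 c' := by
  intro ε hε
  -- constants: |remainder_j| ≤ π α u K₀ with K₀ = 18|c'| + 21 c'², for u = α𝓛 ≤ 1
  set K : ℝ := π * (18 * |c'| + 21 * c' ^ 2) + 1 with hK
  have hK0 : 0 < K := by positivity
  set δ : ℝ := min 1 (ε / K) with hδ
  have hδ0 : 0 < δ := lt_min one_pos (div_pos hε hK0)
  have hδ1 : δ ≤ 1 := min_le_left _ _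
  have hδK : δ * K ≤ ε := by
    have : δ ≤ ε / K := min_le_right _ _
    calc δ * K ≤ ε / K * K := by gcongr
      _ = ε := div_mul_cancel₀ _ hK0.ne'
  refine ⟨⌈Real.exp (π / δ + 1)⌉₊, fun D _ χ hD _ _ j hj => ?_⟩
  have hℓ : π / δ + 1 ≤ ell D := le_ell_of_ceil_exp_le hD
  have hπδ : 0 < π / δ := div_pos Real.pi_pos hδ0
  have hℓ1 : 1 ≤ ell D := by linarith
  have hℓ0 : 0 < ell D := by linarith
  -- u = α𝓛 = π/𝓛⁸ ≤ π/𝓛 ≤ δ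
  have hu : alpha D * ell D = π / ell D ^ 8 := by
    rw [alpha_eq]; field_simp
  have hu0 : 0 ≤ alpha D * ell D := by rw [hu]; positivity
  have hu1 : alpha D * ell D ≤ δ := by
    rw [hu]
    have h8 : ell D ≤ ell D ^ 8 := by
      calc ell D = ell D ^ 1 := (pow_one _).symm
        _ ≤ ell D ^ 8 := pow_le_pow_right₀ hℓ1 (by norm_num)
    have hℓ' : π / δ ≤ ell D := by linarith
    calc π / ell D ^ 8 ≤ π / ell D := by gcongr
      _ ≤ δ := by
          rw [div_le_iff₀ hℓ0]
          calc π = π / δ * δ := (div_mul_cancel₀ _ hδ0.ne').symm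
            _ ≤ ell D * δ := by gcongr
            _ = δ * ell D := mul_comm _ _
  have huδ1 : alpha D * ell D ≤ 1 := hu1.trans hδ1
  have hα0 : 0 ≤ alpha D := by rw [alpha_eq]; positivity
  obtain ⟨e1, e2, e3⟩ := betaProd_cases c' hℓ0
  -- common final step
  have fin : ∀ A B : ℝ, |A| * |c'| + |B| * c' ^ 2 ≤ 18 * |c'| + 21 * c' ^ 2 →
      |π * alpha D * (alpha D * ell D) * (A * c' + B * c' ^ 2 * (alpha D * ell D))| ≤
        ε * alpha D := by
    intro A B hAB
    refine (abs_remainder_le hα0 hu0 huδ1).trans ?_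
    calc π * alpha D * (alpha D * ell D) * (|A| * |c'| + |B| * c' ^ 2)
        ≤ π * alpha D * δ * (18 * |c'| + 21 * c' ^ 2) := by gcongr
      _ = alpha D * (δ * (π * (18 * |c'| + 21 * c' ^ 2))) := by ring
      _ ≤ alpha D * (δ * K) := by gcongr; linarith
      _ ≤ alpha D * ε := by gcongr
      _ = ε * alpha D := mul_comm _ _
  simp only [Finset.mem_insert, Finset.mem_singleton] at hj
  rcases hj with rfl | rfl | rfl
  · -- j = 1
    rw [show (1 + 1 : ℕ) = 2 from rfl, show (1 + 2 : ℕ) = 3 from rfl, e1, Complex.norm_real,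
      Real.norm_eq_abs]
    have h := fin 0 6 (by norm_num; nlinarith [abs_nonneg c', sq_nonneg c'])
    have e : π * alpha D * (alpha D * ell D) * (0 * c' + 6 * c' ^ 2 * (alpha D * ell D)) =
        6 * π * c' ^ 2 * alpha D * (alpha D * ell D) ^ 2 := by ring
    rwa [e] at h
  · -- j = 2
    rw [show (2 + 1 : ℕ) = 3 from rfl, show (2 + 2 : ℕ) = 4 from rfl, e2, Complex.norm_real,
      Real.norm_eq_abs]
    have h := fin 18 (-15) (by norm_num; nlinarith [sq_nonneg c'])
    have e : π * alpha D * (alpha D * ell D) * (18 * c' + -15 * c' ^ 2 * (alpha D * ell D)) =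
        π * alpha D * (alpha D * ell D) * (18 * c' - 15 * c' ^ 2 * (alpha D * ell D)) := by ring
    rwa [e] at h
  · -- j = 3
    rw [show (3 + 1 : ℕ) = 4 from rfl, show (3 + 2 : ℕ) = 5 from rfl, e3, Complex.norm_real,
      Real.norm_eq_abs]
    have h := fin 8 10 (by norm_num; nlinarith [abs_nonneg c', sq_nonneg c'])
    exact h

variable (c' : ℝ) in
/-- `BetaProd1039` — `_holds` alias of `betaProd1039_holds` above under the fact's exact name, stated under the
prover's own binders as section variables (appended 2026-08-28, D-0026 bookkeeping: the proof term is the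
existing theorem of this file; no statement, definition or attribute is edited; no new named fact; the
ledger's debt table listed the fact unproved). [cite: Zhang2022LandauSiegel, §10 p. 58] -/
theorem _root_.Literature.NumberTheory.LFunctions.Zhang2022.Typed.Sec10B.BetaProd1039_holds :
    _root_.Literature.NumberTheory.LFunctions.Zhang2022.Typed.Sec10B.BetaProd1039 c' :=
  _root_.Literature.NumberTheory.LFunctions.Zhang2022.Typed.Sec10B.betaProd1039_holds (c' := c')

end Literature.NumberTheory.LFunctions.Zhang2022.Typed.Sec10B
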